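import Summits.Ventures.PercRepro.S1TriangleVCount
import Summits.Ventures.PercRepro.S1FourCircuitW
import Summits.Ventures.PercRepro.S1CellCaps

/-!
# PercRepro — the cell `(8, 26)` of the `q = 4` window, by LEMMAS V and W (p2, gen 18)

Two bounds in the size `n = 34` of the ground set — LEMMA V's `s₃ ≤ ⌊n²/9⌋ = 128` (`S1TriangleVCount`) and LEMMA
W's `s₄ ≤ ⌊n(n−1)(n−2)/8⌋ = 4488` (`S1FourCircuitW`; the chain's nullity bound gave `4823`) — make the capped cell
inequality `cellOK10 8 26 128 4488` hold (twin `mining/g18/vcells.py` form: `1.0233 → 0.9892`), so the `e`-free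
cores of rank `8` with `34` points satisfy `RLS` at level `4`: the cell `(8, 26)` closes unconditionally.

* `cell_eight_twentysix_vw` — the kernel cell;
* **`c025_core_eight_twentysix`** — the core of rank `8` with `34` points.
Axioms: standard.
-/

open scoped Matroid

namespace PercRepro

namespace S1

open Set

variable {α : Type}

/-- The cell `(8, 26)` with `s₃ ≤ 128 = ⌊34²/9⌋` (LEMMA V) and `s₄ ≤ 4488 = 34·33·32/8` (LEMMA W). -/
theorem cell_eight_twentysix_vw : cellOK10 8 26 128 4488 = true := by decide +kernel

/-- **THE CELL `(8, 26)`**: an `e`-free core of rank `8` with `34` points satisfies `RLS` at level `4`. -/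
theorem c025_core_eight_twentysix (M : Matroid α) [M.Finite] (hR : M.eRank = (8 : ℕ)) (hn : M.E.ncard = 34)
    (hfree : ∀ e ∈ M.E, ∃ A ⊆ M.E \ {e}, e ∉ M.closure A ∧ e ∉ M.closure ((M.E \ {e}) \ A)) :
    ThmN.RLS M 8 4 := by
  have hP : {C : Set α | M.IsCircuit C ∧ C.ncard = 3}.ncard ≤ 128 := by
    have h := core_ncard_triangles_le_sq_div_nine M hfree
    rw [hn] at h
    exact h.trans (by norm_num)
  have hS : {C : Set α | M.IsCircuit C ∧ C.ncard = 4}.ncard ≤ 4488 := by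
    have h := core_ncard_fourCircuits_le_mul_div M hfree
    rw [hn] at h
    exact h.trans (by norm_num)
  exact rls_of_cellOK10 M 8 26 128 4488 (by norm_num) hR hn hfree hP hS (by norm_num) cell_eight_twentysix_vw

end S1

end PercRepro
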